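import Summits.RiemannHypothesis.RiemannHypothesis.Theses.UniversalFactor
import Literature.NumberTheory.LFunctions.DeBruijnHDiv
import Literature.NumberTheory.LFunctions.DeBruijnNewmanConstProofs

/-!
# Disproof of `MediumKernelNoGo` (crux stmt-RiemannHypothesis-2577) — standing adversary's work file

Crux: `∀ a, π/8 ≤ a → a ≤ 32 → ¬ HasOnlyRealZeros F_a`,
`F_a z = ∫ u in Ioi 0, ((Φ u / (1 + u²/a²) : ℝ) : ℂ) * cos (z u)` (Laplace(a)-smoothing of `H_0`).

Findings (this file, all `lean check`ed; `sorry` only in the NEAR-MISSES section):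
* §1 WHY IT RESISTS DISPROOF: `¬ MediumKernelNoGo → LaplaceLoophole` (the route's own target X, expected
  false) and, with the provable-now item `LaguerreLift`, `¬ MediumKernelNoGo → RiemannHypothesis`.
  A disproof of this crux is a proof of RH; no counterexample search can succeed short of that.
* §2 LOAD-BEARING `π/8 ≤ a` (formally: `a ≠ 0`): with the lower bound dropped the statement contains the
  instance `a = 0`, where Lean's `u²/0² = 0` makes the multiplier `1` and `F_0 = H_0`; so the weakened
  crux implies `¬ RH`.  (`F (-a) = F a`, so negative `a` add nothing new.)
* §3 `a ≤ 32` is not load-bearing for truth: dropping it gives exactly `MediumKernelNoGo ∧ NarrowKernelNoGo`.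
* §4 STRUCTURE OF THE ZERO SET the provers can use / must respect: `F_a` is real on `ℝ`, `conj`-symmetric,
  even, and has NO zeros on the imaginary axis (`F_a(iy) > 0`), so the natural strengthening
  "a purely imaginary zero" is refuted for every `a`.
* §6 NUMERICS — VERDICT: NO KILL; the crux is numerically TRUE on all of [π/8, 32] with explicit, cheaply
  certifiable witnesses (kit jobs j004819, j004904 `uf-lehmer-*`, j005074/j005077 `uf-lowheight-*`; python-flint/Arb
  ζ cross-checked against mpmath to 2e-23; F_a evaluated as (a/2)∫H_0(z−y)e^{−a|y|}dy by Gauss–Legendre panels, and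
  independently from the u-integral at matched precision — the two agree to 1e-5…1e-7; values at height 14010 carry
  the constant factor e^{π·14010/8}). Details and tables: NOTES.md of this seat / job outputs attached to the item.
  (A) LEHMER MECHANISM, a ∈ [1.5, 37.47): H_0 vanishes at z₁ = 14010.1257323498, z₂ = 14010.2011293453 (= 2γ of
      Lehmer's pair; z-gap 0.0753969954526, neighbours at 14008.08 and 14013.46). Measured threshold a* = 37.473
      (the two real zeros of F_a merge and leave the axis for a < a*; quadratic model √2/δ = 37.514; fine-quadrature
      bracket d(37.423) < 0 < d(37.523)); so a = 32 has a 17 % margin in a (smoothing variance 2/a² exceeds δ² by 37 %).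
      Newton continuation of the complex zero z(a) = x(a) + i·y(a) (relative residuals ≤ 1e-18):
        a    : 37.25   37     36     35     34     33     32       30     28     26     24     22     20     18
        y(a) : .00413 .00605 .01089 .01442 .01746 .02028 .022965  .02821 .03352 .03911 .04518 .05195 .05969 .06877
        a    : 16      14     12     10     9      8      7        6      5.5    5      4.5    4      3.5    3
        y(a) : .079745 .09345 .11129 .13573 .15180 .17169 .19703  .23045 .25152 .27662 .30701 .34455 .39205 .45394
        a    : 2.75    2.5    2.25   2.0    1.8    1.6    1.5
        y(a) : .49241 .53758 .59125 .65587 .71766 .79090 .83272      (x(a) = 14010.16343 for a ≥ 16, drifting to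
      14010.1519 at a = 3, 14010.1228 at a = 2, 14010.0766 at a = 1.5; y(a) ≈ √(2/a² − δ²) to 1 % for a ≥ 6).
      WINDING NUMBER 1 verified (≥ 16 points per edge, max argument jump < 0.8 rad) around
        a = 32: [14010.0134, 14010.3134] × [0.01148, 0.03674];   a = 16: [14010.0134, 14010.3134] × [0.03987, 0.12759];
        a = 6 : [14010.0124, 14010.3124] × [0.11522, 0.36872];   a = 3 : [14010.0019, 14010.3019] × [0.22697, 0.72630];
      and for a = 32, 16, 6 the real function F_a has NO sign change on [14009.3, 14011.0] (H_0: two). At a = 37.5 > a*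
      Newton falls back onto the real axis (two real zeros persist), consistent with the threshold.
      ⇒ `LehmerPointNoGo` (a = 16) witness: z ≈ 14010.1634038892 + 0.0797447675 i.
  (B) LOW HEIGHTS, small a (x ≤ 600, t ≤ 300; H_0 has 138 zeros there = N(300)): real sign changes of F_a number only
      20 (a = π/8), 24 (0.45), 69 (0.7), 99 (1.0) — massive real-zero deficits at LOW height (at a = π/8 the left
      memory ∫^x H_0 e^{πw/8} behaves like x^{7/4}∫^{x/2} Z, whose drift Ω±(T^{1/4}) swamps the local oscillation).
      Complex zeros (Newton on the u-integral, relative residuals ≤ 3e-21):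
        a = π/8 : 48.767506590856 + 1.7551842710977 i,  65.430553698873 + 4.965964498401 i;
        a = 0.45: 65.387334670016 + 3.6277698772551 i,  80.87075344043 + 2.7390557274654 i;
        a = 0.70: 98.985141674369 + 1.6104650469244 i,  120.76437085929 + 1.007493217503 i;
        a = 1.00: 153.56479415985 + 0.16900217649477 i, 223.59819054695 + 1.414228888646 i.
      Rule of thumb confirmed: a complex pair of F_a sits near every consecutive pair of H_0-zeros with z-gap ≲ 2√2/a
      (a = 1, x = 153.6: ζ-zeros 75.70/77.14, z-gap 2.88 ≈ 2√2, hence y only 0.169).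
  (C) CONSEQUENCE FOR THE LINE: the planner's three regimes collapse to TWO certificate families — (A) one tracked zero
      near 14010.16 + i y(a) on a ∈ [1.5, 32] (5 boxes with y-ranges [y/2, 2y] on a-intervals [a, 1.9a] suffice since
      y ∝ 1/a), (B) zeros below x = 250 for a ∈ [π/8, 1.5] — no band-limit heights 10⁶…10¹¹, no special treatment of
      [3, 6] or of a = π/8 (F_a is jointly continuous in (a, z), and the a = π/8 witness sits at x = 48.8).
      Pending at this version: j005077 (a up to 3, x ≤ 4400) to fill a ∈ (1, 1.5) from the low side (job A already
      covers 1.5 ≤ a).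
* GATE: refuters land only `¬ <Theses decl>` files; everything here travels as item evidence (dry-run p— bounced
  `theorems.refuter`), provers/planners may copy lemmas from this file.
* Targets (lead's stuck stubs): none handed over yet (payload.stuck_stubs = []).
-/

noncomputable section

open Complex MeasureTheory Set
open scoped ComplexConjugate

namespace Summit.RiemannHypothesis.RiemannHypothesis.Cruxes.MediumKernelNoGo.Disproof

open Literature.NumberTheory.LFunctions
open Summit.RiemannHypothesis.RiemannHypothesis.Theses.UniversalFactor

/-- The route's Laplace-smoothed transform `F_a`, literally the lambda inlined in every item. -/
def F (a : ℝ) : ℂ → ℂ := fun z : ℂ =>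
  ∫ u in Set.Ioi (0:ℝ), ((deBruijnPhi u / (1 + u ^ 2 / a ^ 2) : ℝ) : ℂ) * Complex.cos (z * u)

/-- `F a` is the tree's `deBruijnHDiv` of the Laplace multiplier (definitional). -/
theorem F_eq_deBruijnHDiv (a : ℝ) : F a = deBruijnHDiv (fun u : ℝ => 1 + u ^ 2 / a ^ 2) := rfl

/-- Unfolding: the crux is `∀ a ∈ [π/8, 32], ¬ HasOnlyRealZeros (F a)`. -/
theorem mediumKernelNoGo_iff :
    MediumKernelNoGo ↔ ∀ a : ℝ, Real.pi / 8 ≤ a → a ≤ 32 → ¬ HasOnlyRealZeros (F a) := Iff.rfl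

/-! ## §1 Why it resists: a disproof is a proof of the target X (hence of RH) -/

/-- `¬ crux` hands over an `a ∈ [π/8, 32]` with `F_a` real-rooted, i.e. the route's target
`LaplaceLoophole` (Cardon's Question 7 answered positively). -/
theorem laplaceLoophole_of_not_mediumKernelNoGo (h : ¬ MediumKernelNoGo) : LaplaceLoophole := by
  simp only [mediumKernelNoGo_iff, not_forall, not_not] at h
  obtain ⟨a, ha, _, hreal⟩ := h
  refine ⟨a, lt_of_lt_of_le (by positivity) ha, hreal⟩

/-- With the (provable-now) support item `LaguerreLift`, a disproof of the crux proves RH. -/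
theorem riemannHypothesis_of_not_mediumKernelNoGo (hL : LaguerreLift) (h : ¬ MediumKernelNoGo) :
    _root_.RiemannHypothesis := by
  obtain ⟨a, ha, hreal⟩ := laplaceLoophole_of_not_mediumKernelNoGo h
  exact riemannHypothesis_iff_hasOnlyRealZeros_deBruijnH_zero_holds.2 (hL a ha hreal)

/-- Contrapositive bookkeeping: under `LaguerreLift`, `¬ RH → MediumKernelNoGo`. -/
theorem mediumKernelNoGo_of_not_RH (hL : LaguerreLift) (h : ¬ _root_.RiemannHypothesis) :
    MediumKernelNoGo := by
  by_contra hc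
  exact h (riemannHypothesis_of_not_mediumKernelNoGo hL hc)

/-! ## §2 The lower bound is load-bearing (drop it and the statement asserts `¬ RH`) -/

/-- The crux with `π/8 ≤ a` dropped. -/
def MediumKernelNoGoWithoutLower : Prop :=
  ∀ a : ℝ, a ≤ 32 → ¬ HasOnlyRealZeros (F a)

/-- Junk arithmetic at `a = 0`: `u ^ 2 / 0 ^ 2 = 0`, so the multiplier is `1` and `F 0 = H_0`. -/
theorem F_zero_eq : F 0 = deBruijnH 0 := by
  rw [F_eq_deBruijnHDiv, ← deBruijnHDiv_one']
  congr 1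
  funext u
  simp

/-- `F` is even in the parameter: only `a²` enters. -/
theorem F_neg (a : ℝ) : F (-a) = F a := by
  simp [F_eq_deBruijnHDiv]

/-- Dropping the lower bound makes the crux imply `¬ RH` (instance `a = 0`). Any proof of the
weakened statement would refute RH; so every proof of the crux must use `a ≠ 0` (here: `π/8 ≤ a`). -/
theorem not_RH_of_withoutLower (h : MediumKernelNoGoWithoutLower) : ¬ _root_.RiemannHypothesis := by
  intro hRH
  have h0 := h 0 (by norm_num)
  rw [F_zero_eq] at h0
  exact h0 (riemannHypothesis_iff_hasOnlyRealZeros_deBruijnH_zero_holds.1 hRH)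

/-- `F` depends on `a` only through `|a|`. -/
theorem F_abs (a : ℝ) : F |a| = F a := by
  simp [F_eq_deBruijnHDiv, sq_abs]

/-- What the weakened statement really says: since `a ≤ 32` also admits every `a ≤ 0`, and
`F (-a) = F a`, dropping the lower bound gives exactly "`H_0` has a non-real zero (i.e. `¬ RH`) and the
route's target X fails for EVERY `a > 0`". -/
theorem withoutLower_iff :
    MediumKernelNoGoWithoutLower ↔ ¬ HasOnlyRealZeros (deBruijnH 0) ∧ ¬ LaplaceLoophole := by
  constructor
  · intro h
    refine ⟨F_zero_eq ▸ h 0 (by norm_num), ?_⟩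
    rintro ⟨a, ha, hreal⟩
    have h' := h (-a) (by linarith)
    rw [F_neg] at h'
    exact h' hreal
  · rintro ⟨h0, hX⟩ a _ hreal
    rcases eq_or_ne a 0 with rfl | hne
    · rw [F_zero_eq] at hreal
      exact h0 hreal
    · refine hX ⟨|a|, abs_pos.2 hne, ?_⟩
      show HasOnlyRealZeros (F |a|)
      rw [F_abs]
      exact hreal

/-! ## §3 The upper bound is not load-bearing for truth (only for the method) -/

/-- The crux with `a ≤ 32` dropped. -/
def MediumKernelNoGoWithoutUpper : Prop :=
  ∀ a : ℝ, Real.pi / 8 ≤ a → ¬ HasOnlyRealZeros (F a)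

/-- Dropping `a ≤ 32` yields precisely the conjunction with the sibling crux `NarrowKernelNoGo`
(expected true, inaccessible to certified computation as `a → ∞`): no refutation is possible here
either without deciding generalised Newman on the whole ray. -/
theorem withoutUpper_iff : MediumKernelNoGoWithoutUpper ↔ MediumKernelNoGo ∧ NarrowKernelNoGo := by
  constructor
  · intro h
    refine ⟨fun a ha _ => h a ha, fun a ha => h a (le_trans ?_ ha)⟩
    have : Real.pi ≤ 4 := Real.pi_le_four
    linarith
  · rintro ⟨hM, hN⟩ a ha
    by_cases h32 : a ≤ 32
    · exact hM a ha h32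
    · exact hN a (by linarith)

/-! ## §4 Structure of the zero set (usable by provers; kills the strengthening "an imaginary-axis zero") -/

/-- `F_a` is real on the real axis. -/
theorem F_ofReal_im (a x : ℝ) : (F a x).im = 0 := deBruijnHDiv_ofReal_im _ x

/-- Conjugation symmetry `conj (F_a z) = F_a (conj z)`. -/
theorem conj_F (a : ℝ) (z : ℂ) : conj (F a z) = F a (conj z) := conj_deBruijnHDiv _ z

/-- `F_a` is even. -/
theorem F_neg_arg (a : ℝ) (z : ℂ) : F a (-z) = F a z := deBruijnHDiv_neg _ z

/-- Non-real zeros come in conjugate pairs. -/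
theorem F_conj_eq_zero_iff (a : ℝ) (z : ℂ) : F a (conj z) = 0 ↔ F a z = 0 := by
  rw [← conj_F]
  exact map_eq_zero (starRingEnd ℂ)

/-- On the imaginary axis the transform is a real integral of a POSITIVE function:
`F_a(iy) = ∫₀^∞ Φ(u)/(1+u²/a²) · cosh(yu) du`. -/
theorem F_I_mul (a y : ℝ) :
    F a (I * y) = ((∫ u in Ioi (0:ℝ), deBruijnPhi u / (1 + u ^ 2 / a ^ 2) * Real.cosh (y * u) : ℝ) : ℂ) := by
  rw [← integral_complex_ofReal]
  simp only [F]
  refine setIntegral_congr_fun measurableSet_Ioi fun u _ => ?_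
  rw [show (I * (y : ℂ) * (u : ℂ) : ℂ) = ((y * u : ℝ) : ℂ) * I by push_cast; ring, Complex.cos_mul_I,
    ← Complex.ofReal_cosh]
  push_cast
  ring

/-- The integrand on the imaginary axis is positive on `(0, ∞)`. -/
theorem integrand_I_pos (a y : ℝ) {u : ℝ} (hu : 0 < u) :
    0 < deBruijnPhi u / (1 + u ^ 2 / a ^ 2) * Real.cosh (y * u) :=
  mul_pos (div_pos (deBruijnPhi_pos_of_nonneg hu.le) (by positivity)) (Real.cosh_pos _)

/-- The real integrand on the imaginary axis is integrable on `(0, ∞)` (from the tree's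
`IsDivAdmissible.integrableOn_deBruijnHDiv`). -/
theorem integrableOn_integrand_I (a y : ℝ) :
    IntegrableOn (fun u : ℝ => deBruijnPhi u / (1 + u ^ 2 / a ^ 2) * Real.cosh (y * u)) (Ioi 0) := by
  have h := (isDivAdmissible_laplace a).integrableOn_deBruijnHDiv (I * y)
  have h' : IntegrableOn
      (fun u : ℝ => ((deBruijnPhi u / (1 + u ^ 2 / a ^ 2) * Real.cosh (y * u) : ℝ) : ℂ)) (Ioi 0) := by
    refine h.congr_fun (fun u _ => ?_) measurableSet_Ioi
    simp only
    rw [show (I * (y : ℂ) * (u : ℂ) : ℂ) = ((y * u : ℝ) : ℂ) * I by push_cast; ring, Complex.cos_mul_I,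
      ← Complex.ofReal_cosh]
    push_cast
    ring
  have h'' := MeasureTheory.Integrable.re h'
  simp only [RCLike.re_to_complex, Complex.ofReal_re] at h''
  exact h''

/-- **No purely imaginary zeros**: `Re F_a(iy) > 0` for every real `a, y`. -/
theorem F_I_mul_re_pos (a y : ℝ) : 0 < (F a (I * y)).re := by
  rw [F_I_mul, Complex.ofReal_re]
  refine (setIntegral_pos_iff_support_of_nonneg_ae ?_ (integrableOn_integrand_I a y)).2 ?_
  · exact ae_restrict_of_forall_mem measurableSet_Ioi fun u hu => (integrand_I_pos a y hu).le
  · have hs : Function.support (fun u : ℝ => deBruijnPhi u / (1 + u ^ 2 / a ^ 2) * Real.cosh (y * u)) ∩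
        Ioi 0 = Ioi 0 := by
      ext u
      simp only [mem_inter_iff, Function.mem_support, mem_Ioi]
      exact ⟨And.right, fun hu => ⟨(integrand_I_pos a y hu).ne', hu⟩⟩
    rw [hs, Real.volume_Ioi]
    exact ENNReal.zero_lt_top

/-- Hence `F_a(iy) ≠ 0`; in particular `F_a(0) ≠ 0` and `F_a ≢ 0` (no vacuous `HasOnlyRealZeros`
failure, no cheap witness on the axis of symmetry). -/
theorem F_I_mul_ne_zero (a y : ℝ) : F a (I * y) ≠ 0 := by
  intro h
  have := F_I_mul_re_pos a y
  rw [h, Complex.zero_re] at this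
  exact lt_irrefl _ this

/-- REFUTED STRENGTHENING (all `a`): "`F_a` has a zero on the imaginary axis". The non-real zero that
`MediumKernelNoGo` asks for must have `Re z ≠ 0` (numerically: `Re z ≈ 14010.16` from Lehmer's pair). -/
theorem not_exists_imaginaryAxis_zero (a : ℝ) : ¬ ∃ y : ℝ, F a (I * y) = 0 := by
  rintro ⟨y, hy⟩
  exact F_I_mul_ne_zero a y hy

/-! ## §5 Shape of a certificate: one zero in the OPEN first quadrant per `a` -/

/-- `F_a(0) ≠ 0` (so `F_a ≢ 0`: `HasOnlyRealZeros (F a)` is never vacuously false). -/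
theorem F_apply_zero_ne_zero (a : ℝ) : F a 0 ≠ 0 := by
  simpa using F_I_mul_ne_zero a 0

/-- Pointwise form of the negated conclusion: by conjugation symmetry, evenness and the absence of
imaginary-axis zeros, "`F_a` has a non-real zero" is equivalent to "`F_a` has a zero with
`Im z > 0` and `Re z > 0`". This is exactly what a certificate (argument principle on a box in the
open first quadrant) has to produce — e.g. for `LehmerPointNoGo` (`a = 16`). -/
theorem not_hasOnlyRealZeros_F_iff (a : ℝ) :
    ¬ HasOnlyRealZeros (F a) ↔ ∃ z : ℂ, F a z = 0 ∧ 0 < z.im ∧ 0 < z.re := by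
  constructor
  · intro h
    simp only [HasOnlyRealZeros, not_forall, exists_prop] at h
    obtain ⟨z, hz, him⟩ := h
    obtain ⟨w, hw, hwim⟩ : ∃ w : ℂ, F a w = 0 ∧ 0 < w.im := by
      rcases lt_or_gt_of_ne him with hlt | hgt
      · exact ⟨conj z, (F_conj_eq_zero_iff a z).2 hz, by simpa using hlt⟩
      · exact ⟨z, hz, hgt⟩
    rcases lt_trichotomy w.re 0 with hlt | heq | hgt
    · refine ⟨-conj w, ?_, ?_, ?_⟩
      · rw [F_neg_arg, F_conj_eq_zero_iff]
        exact hw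
      · simpa using hwim
      · simpa using hlt
    · exfalso
      have hwI : w = I * (w.im : ℂ) := by
        apply Complex.ext <;> simp [heq]
      rw [hwI] at hw
      exact F_I_mul_ne_zero a w.im hw
    · exact ⟨w, hw, hwim, hgt⟩
  · rintro ⟨z, hz, him, -⟩ h
    exact him.ne' (h z hz)

/-- The crux, unfolded to its certificate shape. -/
theorem mediumKernelNoGo_iff_exists_quadrant :
    MediumKernelNoGo ↔
      ∀ a : ℝ, Real.pi / 8 ≤ a → a ≤ 32 → ∃ z : ℂ, F a z = 0 ∧ 0 < z.im ∧ 0 < z.re := by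
  simp only [mediumKernelNoGo_iff, not_hasOnlyRealZeros_F_iff]

/-- Same for the calibration item `LehmerPointNoGo` (`a = 16`), which the crux implies. -/
theorem lehmerPointNoGo_iff_exists_quadrant :
    LehmerPointNoGo ↔ ∃ z : ℂ, F 16 z = 0 ∧ 0 < z.im ∧ 0 < z.re :=
  not_hasOnlyRealZeros_F_iff 16

theorem lehmerPointNoGo_of_mediumKernelNoGo (h : MediumKernelNoGo) : LehmerPointNoGo :=
  h 16 (by have := Real.pi_le_four; linarith) (by norm_num)

end Summit.RiemannHypothesis.RiemannHypothesis.Cruxes.MediumKernelNoGo.Disproof
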